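import Summits.ResolutionOfSingularities.ResolutionOfSingularities.Theorems.FrobeniusLadderFInjectiveMacaulayficationT11SpecimenDoorGeneric
import HarnessLib

/-!
# THE SPECIMEN DOOR FOR `T₁₁⁺` IN CHARACTERISTIC `3` (the c.i. `V(Φ−y²−x³, z²+Φ³+x¹¹+w⁷) ⊂ 𝔸⁵` is REGULAR OFF THE ORIGIN at `p = 3`):
# `hoff₃` and the crux conclusion for `T₁₁⁺/3` modulo point-fixability at the origin
# (crux `FrobeniusLadder.FInjectiveMacaulayfication` stmt-ResolutionOfSingularities-15315, chain w45a, road E7 = the T₁₁/3 instance;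
# res-L1-w45a-plan-1 CRUX-PLAN v17 §2 row «ROAD E7 T₁₁/3 … hoff₃»; seat res-L1-w45a-stub-3)

[OURS · L1 W4.5a] AI-written; AI review is weaker than expert review. NOT a statement of any manuscript; no named fact.

`F₀ = Φ − y² − x³`, `F₁ = z² + Φ³ + x¹¹ + w⁷` in `k[x,y,z,w,Φ] = MvPolynomial (Fin 5) k` (order `(x,y,z,w,Φ) = (X 0,…,X 4)`, the conventions of
`T11PlusPrime` / `T11PlusOffStratum` / `T11SpecimenDoor` / `T11SpecimenDoorGeneric`). The generic door `T11SpecimenDoorGeneric` (res-L1-w45a-stub-2)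
excludes `p = 3` because its argument uses the `(∂_y, ∂_Φ)`-minor `−6yΦ²`, which vanishes identically in characteristic `3`. It is not needed:
in characteristic `3` the `(∂_x, ∂_Φ)`-minor `−9x²Φ² − 11x¹⁰` IS `x¹⁰` up to the unit `−11 = 1`, so a prime `P ⊇ (F₀, F₁)` containing the three
minors `−2z`, `−7w⁶`, `−9x²Φ² − 11x¹⁰` contains `z, w, x`, hence `Φ³ = F₁ − z² − x¹¹ − w⁷ ∈ P`, `Φ ∈ P`, `y² = Φ − x³ − F₀ ∈ P`, `y ∈ P` — `P` is
the origin. So `T₁₁⁺/3` is regular at every point other than the origin, exactly as for `p ∉ {2,3,7,11}`, and stub-6's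
`CIJacobian.ci_clause_of_det_not_mem` yields the per-stalk clause of the crux there.

* `exists_det_not_mem_char3` — off the origin one of the minors `det_z`, `det_w`, `det_x` (BY NAME from `T11SpecimenDoorGeneric`) is not in `P`
  (needs only `2, 7, 11 ≠ 0` and `9 = 0` in `k`);
* `t11Plus_hoff_char3` — **`hoff₃`**: the `hoff` binder of `SpecimenDoor.fInjectiveMacaulayfication_of_originPointFixable` for `T₁₁⁺`, `p = 3`;
* `fInjectiveMacaulayfication_T11plus_char3_of_h0` — **THE DOOR AT `p = 3`**: if the stalk at the origin is point-fixable (`h0`, the `PFix₃` text),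
  then `X = T₁₁⁺/k` (`char k = 3`) has a proper birational model all of whose stalks are domains with the Cohen–Macaulay +
  Frobenius-closed-parameter-ideals clause (generic door ∘ `T11PlusPrime` ∘ `QuotientOriginMaximal` ∘ `hoff₃` ∘ `T11SpecimenDoor.cmClause_of_isMaximal`);
  the E7 instance `T11OriginPointFixableChar3` (res-L1-w45a-lead-1, two-level tower) discharges `h0` through
  `T11PlusOriginTransportStalk.t11Plus_h0_of_hypersurface_h0 (p := 3)`.

No definitions, no named facts. [cite: Matsumura1987, Thm. 30.4 (ii), Thm. 14.2]
-/

set_option linter.dupNamespace false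

noncomputable section

namespace Summit.ResolutionOfSingularities.ResolutionOfSingularities.Theorems.FInjectiveMacaulayfication.T11SpecimenDoorChar3

open MvPolynomial AlgebraicGeometry
open Summit.ResolutionOfSingularities.ResolutionOfSingularities.Theorems.FInjectiveMacaulayfication
open T11SpecimenDoorGeneric

variable {k : Type} [Field k]

/-! ## §1 Off the origin some minor is a unit at the point, characteristic `3` -/

/-- **Off the origin, one of the three minors `det_z`, `det_w`, `det_x` is not in `P`** (`P ⊇ (F₀, F₁)` prime, some variable `∉ P`),
provided `2, 7, 11 ≠ 0` and `9 = 0` in `k` (characteristic `3`): the minors force `z, w ∈ P` and — since the `x`-minor is `−11·x¹⁰` when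
`9 = 0` — `x ∈ P`; then `Φ³ ∈ P` from `F₁` and `y² ∈ P` from `F₀`, so every variable is in `P`. [folklore] -/
theorem exists_det_not_mem_char3 (h2 : (2 : k) ≠ 0) (h7 : (7 : k) ≠ 0) (h11 : (11 : k) ≠ 0) (h9 : (9 : k) = 0)
    (Fs : Fin 2 → MvPolynomial (Fin 5) k)
    (hF₀ : Fs 0 = X 4 - X 1 ^ 2 - X 0 ^ 3) (hF₁ : Fs 1 = X 2 ^ 2 + X 4 ^ 3 + X 0 ^ 11 + X 3 ^ 7)
    (P : Ideal (MvPolynomial (Fin 5) k)) [hP : P.IsPrime] (hF₀P : Fs 0 ∈ P) (hF₁P : Fs 1 ∈ P)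
    (hj : ∃ j : Fin 5, (X j : MvPolynomial (Fin 5) k) ∉ P) :
    ∃ D : Fin 2 → Derivation ℤ (MvPolynomial (Fin 5) k) (MvPolynomial (Fin 5) k), (Matrix.of fun i j => D i (Fs j)).det ∉ P := by
  by_contra hcon
  push Not at hcon
  have hz : (X 2 : MvPolynomial (Fin 5) k) ∈ P := by
    have h := hcon ![(pderiv 2).restrictScalars ℤ, (pderiv 4).restrictScalars ℤ]
    rw [det_z Fs hF₀ hF₁] at h
    exact ((hP.mem_or_mem h).resolve_left (C_not_mem hP.ne_top (neg_ne_zero.mpr h2)))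
  have hw : (X 3 : MvPolynomial (Fin 5) k) ∈ P := by
    have h := hcon ![(pderiv 3).restrictScalars ℤ, (pderiv 4).restrictScalars ℤ]
    rw [det_w Fs hF₀ hF₁] at h
    exact hP.mem_of_pow_mem 6 ((hP.mem_or_mem h).resolve_left (C_not_mem hP.ne_top (neg_ne_zero.mpr h7)))
  have hx : (X 0 : MvPolynomial (Fin 5) k) ∈ P := by
    have h := hcon ![(pderiv 0).restrictScalars ℤ, (pderiv 4).restrictScalars ℤ]
    rw [det_x Fs hF₀ hF₁] at h
    -- in characteristic `3` the `x`-minor is `C (-11) * x¹⁰`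
    have h9' : (C (-9) : MvPolynomial (Fin 5) k) = 0 := by rw [show (-9 : k) = -(9 : k) from rfl, h9, neg_zero, map_zero]
    rw [h9', zero_mul, zero_mul, zero_add] at h
    exact hP.mem_of_pow_mem 10 ((hP.mem_or_mem h).resolve_left (C_not_mem hP.ne_top (neg_ne_zero.mpr h11)))
  have hΦ : (X 4 : MvPolynomial (Fin 5) k) ∈ P := by
    have h3 : (X 4 ^ 3 : MvPolynomial (Fin 5) k) ∈ P := by
      have : (X 4 ^ 3 : MvPolynomial (Fin 5) k) = Fs 1 - X 2 * X 2 - X 0 * X 0 ^ 10 - X 3 * X 3 ^ 6 := by rw [hF₁]; ring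
      rw [this]
      exact sub_mem (sub_mem (sub_mem hF₁P (Ideal.mul_mem_right _ _ hz)) (Ideal.mul_mem_right _ _ hx))
        (Ideal.mul_mem_right _ _ hw)
    exact hP.mem_of_pow_mem 3 h3
  have hy : (X 1 : MvPolynomial (Fin 5) k) ∈ P := by
    have h : (X 1 ^ 2 : MvPolynomial (Fin 5) k) ∈ P := by
      have : (X 1 ^ 2 : MvPolynomial (Fin 5) k) = X 4 - X 0 * X 0 ^ 2 - Fs 0 := by rw [hF₀]; ring
      rw [this]
      exact sub_mem (sub_mem hΦ (Ideal.mul_mem_right _ _ hx)) hF₀P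
    exact hP.mem_of_pow_mem 2 h
  obtain ⟨j, hj⟩ := hj
  apply hj
  fin_cases j
  · exact hx
  · exact hy
  · exact hz
  · exact hw
  · exact hΦ

/-! ## §2 The `hoff` binder at `p = 3` -/

/-- **`hoff₃` FOR `T₁₁⁺`** — the hypothesis `hoff` of `SpecimenDoor.fInjectiveMacaulayfication_of_originPointFixable` for
`Fs 0 = Φ − y² − x³`, `Fs 1 = z² + Φ³ + x¹¹ + w⁷`, `char k = 3`: at every maximal ideal `Q` of `k[X]/(Fs)` missing some `x̄ⱼ` the local ring
is regular, hence every system of parameters is weakly regular and generates a Frobenius-closed ideal (`CIJacobian.ci_clause_of_det_not_mem`).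
[cite: Matsumura1987, Thm. 30.4 (ii) and Thm. 14.2] -/
theorem t11Plus_hoff_char3 (k : Type) [Field k] [CharP k 3] (Fs : Fin 2 → MvPolynomial (Fin 5) k)
    (hF₀ : Fs 0 = X 4 - X 1 ^ 2 - X 0 ^ 3) (hF₁ : Fs 1 = X 2 ^ 2 + X 4 ^ 3 + X 0 ^ 11 + X 3 ^ 7) :
    ∀ (Q : Ideal (MvPolynomial (Fin 5) k ⧸ Ideal.span (Set.range Fs))) [Q.IsMaximal],
      (∃ j : Fin 5, Ideal.Quotient.mk (Ideal.span (Set.range Fs)) (X j) ∉ Q) →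
      ∀ d : ℕ, ringKrullDim (Localization.AtPrime Q) = d → ∀ s : Fin d → Localization.AtPrime Q,
        (Ideal.span (Set.range s)).radical.IsMaximal →
          RingTheory.Sequence.IsWeaklyRegular (Localization.AtPrime Q) (List.ofFn s) ∧
          ∀ y : Localization.AtPrime Q, (∃ e : ℕ, y ^ 3 ^ e ∈ Ideal.span ((fun z : Localization.AtPrime Q => z ^ 3 ^ e) ''
            (Ideal.span (Set.range s) : Set (Localization.AtPrime Q)))) → y ∈ Ideal.span (Set.range s) := by
  intro Q hQ hj
  haveI : Fact (Nat.Prime 3) := ⟨Nat.prime_three⟩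
  set P := Q.comap (Ideal.Quotient.mk (Ideal.span (Set.range Fs))) with hPdef
  haveI : P.IsPrime := Ideal.comap_isPrime _ _
  have hFP : ∀ l : Fin 2, Fs l ∈ P := fun l => by
    rw [hPdef, Ideal.mem_comap, Ideal.Quotient.eq_zero_iff_mem.mpr (Ideal.subset_span (Set.mem_range_self l))]
    exact Q.zero_mem
  have hj' : ∃ j : Fin 5, (X j : MvPolynomial (Fin 5) k) ∉ P := by
    obtain ⟨j, hj⟩ := hj
    exact ⟨j, fun h => hj (Ideal.mem_comap.mp h)⟩
  have h2 : (2 : k) ≠ 0 := by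
    exact_mod_cast FcuspOffCurve.natCast_prime_ne_zero_of_charP_ne (k := k) 3 2 Nat.prime_two (by norm_num)
  have h7 : (7 : k) ≠ 0 := by
    exact_mod_cast FcuspOffCurve.natCast_prime_ne_zero_of_charP_ne (k := k) 3 7 (by norm_num) (by norm_num)
  have h11 : (11 : k) ≠ 0 := by
    exact_mod_cast FcuspOffCurve.natCast_prime_ne_zero_of_charP_ne (k := k) 3 11 (by norm_num) (by norm_num)
  have h9 : (9 : k) = 0 := by
    have h3 : ((3 : ℕ) : k) = 0 := CharP.cast_eq_zero k 3
    rw [show (9 : k) = ((3 : ℕ) : k) * ((3 : ℕ) : k) by push_cast; norm_num, h3, zero_mul]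
  obtain ⟨D, hD⟩ := exists_det_not_mem_char3 h2 h7 h11 h9 Fs hF₀ hF₁ P (hFP 0) (hFP 1) hj'
  exact (CIJacobian.ci_clause_of_det_not_mem 3 k 5 2 Fs Q D hD).2.2.1

/-! ## §3 The specimen door for `T₁₁⁺` at `p = 3` -/

/-- **THE SPECIMEN DOOR FOR `T₁₁⁺` AT `p = 3`, MODULO POINT-FIXABILITY AT THE ORIGIN** (the twin of
`T11SpecimenDoor.fInjectiveMacaulayfication_T11plus_char7` and `T11SpecimenDoorGeneric.fInjectiveMacaulayfication_T11plus_char5_of_h0`). For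
`X = Spec k[x,y,z,w,Φ]/(Φ − y² − x³, z² + Φ³ + x¹¹ + w⁷)`, `char k = 3`: if the local ring at the origin is point-fixable (`h0`, the `PFix₃` text of
the generic door `SpecimenDoor.fInjectiveMacaulayfication_of_originPointFixable`), then there are a scheme `X'` and a proper birational `π : X' ⟶ X`
such that every stalk of `X'` is a domain in which every system of parameters is weakly regular and generates a Frobenius-closed ideal
(generic door ∘ `T11PlusPrime.t11plus_prime_and_X_ne_zero` ∘ `QuotientOriginMaximal.isMaximal_span_range_mk_X` ∘ `t11Plus_hoff_char3` ∘
`T11SpecimenDoor.cmClause_of_isMaximal`). The E7 two-level-tower instance at `p = 3` discharges `h0` through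
`T11PlusOriginTransportStalk.t11Plus_h0_of_hypersurface_h0 (p := 3)`. [folklore assembly] -/
theorem fInjectiveMacaulayfication_T11plus_char3_of_h0 (k : Type) [Field k] [CharP k 3] (Fs : Fin 2 → MvPolynomial (Fin 5) k)
    (hF₀ : Fs 0 = X 4 - X 1 ^ 2 - X 0 ^ 3) (hF₁ : Fs 1 = X 2 ^ 2 + X 4 ^ 3 + X 0 ^ 11 + X 3 ^ 7)
    (h0 : ∀ b : Spec (.of (MvPolynomial (Fin 5) k ⧸ Ideal.span (Set.range Fs))),
      b.asIdeal = Ideal.span (Set.range fun j : Fin 5 => Ideal.Quotient.mk (Ideal.span (Set.range Fs)) (X j)) →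
      ∃ (m : ℕ) (c : Fin m → (Spec (.of (MvPolynomial (Fin 5) k ⧸ Ideal.span (Set.range Fs)))).presheaf.stalk b),
        Ideal.span (Set.range c) ≠ ⊥ ∧
        (Ideal.span (Set.range c)).radical =
          IsLocalRing.maximalIdeal ((Spec (.of (MvPolynomial (Fin 5) k ⧸ Ideal.span (Set.range Fs)))).presheaf.stalk b) ∧
        ∀ (j : Fin m) (𝔔 : PrimeSpectrum (Literature.AlgebraicGeometry.Resolution.blowupAlgebra (Ideal.span (Set.range c)) (c j))),
          𝔔.asIdeal.comap (algebraMap ((Spec (.of (MvPolynomial (Fin 5) k ⧸ Ideal.span (Set.range Fs)))).presheaf.stalk b)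
            (Literature.AlgebraicGeometry.Resolution.blowupAlgebra (Ideal.span (Set.range c)) (c j))) =
            IsLocalRing.maximalIdeal ((Spec (.of (MvPolynomial (Fin 5) k ⧸ Ideal.span (Set.range Fs)))).presheaf.stalk b) →
          IsDomain (Localization.AtPrime 𝔔.asIdeal) ∧ ∀ d : ℕ, ringKrullDim (Localization.AtPrime 𝔔.asIdeal) = d →
            ∀ s : Fin d → Localization.AtPrime 𝔔.asIdeal, (Ideal.span (Set.range s)).radical.IsMaximal →
              RingTheory.Sequence.IsWeaklyRegular (Localization.AtPrime 𝔔.asIdeal) (List.ofFn s) ∧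
              ∀ y : Localization.AtPrime 𝔔.asIdeal, (∃ e : ℕ, y ^ 3 ^ e ∈
                Ideal.span ((fun z : Localization.AtPrime 𝔔.asIdeal => z ^ 3 ^ e) ''
                  (Ideal.span (Set.range s) : Set (Localization.AtPrime 𝔔.asIdeal)))) → y ∈ Ideal.span (Set.range s)) :
    ∃ (X' : Scheme.{0}) (π : X' ⟶ (Spec (.of (MvPolynomial (Fin 5) k ⧸ Ideal.span (Set.range Fs))))), IsProper π ∧
      Literature.AlgebraicGeometry.Resolution.IsBirational π ∧
      ∀ x : X', IsDomain (X'.presheaf.stalk x) ∧ ∀ d : ℕ, ringKrullDim (X'.presheaf.stalk x) = d →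
        ∀ s : Fin d → X'.presheaf.stalk x, (Ideal.span (Set.range s)).radical.IsMaximal →
          RingTheory.Sequence.IsWeaklyRegular (X'.presheaf.stalk x) (List.ofFn s) ∧
          ∀ y : X'.presheaf.stalk x, (∃ e : ℕ, y ^ 3 ^ e ∈
            Ideal.span ((fun z : X'.presheaf.stalk x => z ^ 3 ^ e) '' (Ideal.span (Set.range s) : Set (X'.presheaf.stalk x)))) →
            y ∈ Ideal.span (Set.range s) := by
  obtain ⟨hprime, -⟩ := T11PlusPrime.t11plus_prime_and_X_ne_zero k Fs hF₀ hF₁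
  exact SpecimenDoor.fInjectiveMacaulayfication_of_originPointFixable 3 Nat.prime_three k 5 2 Fs hprime
    (QuotientOriginMaximal.isMaximal_span_range_mk_X k Fs (constantCoeff_eq_zero Fs hF₀ hF₁))
    (t11Plus_hoff_char3 k Fs hF₀ hF₁)
    (fun Q hQ => T11SpecimenDoor.cmClause_of_isMaximal (Fs 0) (Fs 1) hF₀ hF₁ (Set.range Fs) (range_eq_list Fs) Q hQ) h0

end Summit.ResolutionOfSingularities.ResolutionOfSingularities.Theorems.FInjectiveMacaulayfication.T11SpecimenDoorChar3

end
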